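import Summits.HubbardSuperconductivity.HubbardSuperconductivity.Theorems.AnisotropyChordTransferFibre3Level2Toolkit
import Summits.HubbardSuperconductivity.HubbardSuperconductivity.Theorems.AnisotropyChordTransferFibre3GreenZero
import Summits.HubbardSuperconductivity.HubbardSuperconductivity.Theorems.AnisotropyChordTransferFibre3Dirichlet

/-!
# Route `AnisotropyChord` / H0 rotor rung: PartN35 (Level-2 toolkit) — LEMMA G-MIN, geometric variant `GeomGMin` PROVED

PartN35 = `…Fibre3Level2Toolkit` (theory seat `hubbard-h0-rotor-theory-1`, memo 21 §312; port by `hubbard-h0-rotor-p2`):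
**`geomGMin_holds : GeomGMin L`** — for `0 < λ < 2ε₁`, every `n₀` and every site `r`,
`−G_λ(r) ≤ ½ Σ_{n<n₀} 4ⁿ/(c₀^{n+1} V) + (1/V) Σ_{k≠0} (b(k)/c₀)^{n₀} g(k)`, `c₀ = 4 − λ/2`, `b(k) = 4 − ε(k)`.

Proof: `b` is the Fourier symbol of the entrywise non-negative matrix `B = 2·1 + A/2`; in real space this is the recursion
`S_{n+1}(r) = 2S_n(r) + ½Σ_e S_n(r+e)` for `S_n(r) := Σ_k b(k)ⁿ Re e^{ik·r}` (`b_mul_phase_re`, `S_succ`), whence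
`S_n(r) ≥ 0` (`S_nonneg`, from `S_0 = V·δ`), i.e. `Σ_{k≠0} b(k)ⁿ Re e^{ik·r} ≥ −4ⁿ`.  With the finite geometric identity
`1/(c₀ − b) = Σ_{n<n₀} bⁿ/c₀^{n+1} + (b^{n₀}/c₀^{n₀})/(c₀ − b)` (`geom_identity`) and `g = 1/(2(c₀ − b))`, `|Re e^{ik·r}| ≤ 1`
and `g, b ≥ 0` off the origin, the bound follows.

Nothing here proves superconductivity in the Hubbard model; these are helper lemmas of ONE conditional reduction
(rung stmt-HubbardSuperconductivity-19089).  Prover seat `hubbard-h0-rotor-p3` g0; `--supports stmt-HubbardSuperconductivity-19089`.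
-/

set_option linter.dupNamespace false
set_option autoImplicit false

noncomputable section

open scoped BigOperators
open Complex

namespace Summit.HubbardSuperconductivity.HubbardSuperconductivity.Theorems.AnisotropyChord.Transfer.Fibre3

variable (L : ℕ) [NeZero L]

/-! ## The positivity recursion of `S_n(r) = Σ_k b(k)ⁿ Re e^{ik·r}` -/

/-- `b(k) Re φ_k(r) = 2 Re φ_k(r) + ½ Σ_e Re φ_k(r + e)` (`b = 4 − ε` is the symbol of `2·1 + A/2`). [folklore] -/
theorem b_mul_phase_re (k r : Tor L) :
    (4 - epsT L k) * (phase L k r).re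
      = 2 * (phase L k r).re + (1 / 2) * ((phase L k (r + ex L)).re + (phase L k (r + -ex L)).re
          + (phase L k (r + ey L)).re + (phase L k (r + -ey L)).re) := by
  have h := sum_phase_nn L k
  have hmul : phase L k r * phase L k (ex L) + phase L k r * phase L k (-ex L)
      + phase L k r * phase L k (ey L) + phase L k r * phase L k (-ey L)
      = (((4 - 2 * epsT L k) : ℝ) : ℂ) * phase L k r := by
    rw [← h]; ring
  have hre := congrArg Complex.re hmul
  rw [Complex.re_ofReal_mul] at hre
  simp only [Complex.add_re] at hre
  rw [phase_add, phase_add, phase_add, phase_add]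
  linarith

/-- the recursion `S_{n+1}(r) = 2S_n(r) + ½Σ_e S_n(r+e)`. [folklore] -/
theorem S_succ (n : ℕ) (r : Tor L) :
    ∑ k : Tor L, (4 - epsT L k) ^ (n + 1) * (phase L k r).re
      = 2 * ∑ k : Tor L, (4 - epsT L k) ^ n * (phase L k r).re
        + (1 / 2) * (∑ k : Tor L, (4 - epsT L k) ^ n * (phase L k (r + ex L)).re
            + ∑ k : Tor L, (4 - epsT L k) ^ n * (phase L k (r + -ex L)).re
            + ∑ k : Tor L, (4 - epsT L k) ^ n * (phase L k (r + ey L)).re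
            + ∑ k : Tor L, (4 - epsT L k) ^ n * (phase L k (r + -ey L)).re) := by
  have hpt : ∀ k : Tor L, (4 - epsT L k) ^ (n + 1) * (phase L k r).re
      = 2 * ((4 - epsT L k) ^ n * (phase L k r).re)
        + (1 / 2) * ((4 - epsT L k) ^ n * (phase L k (r + ex L)).re
            + (4 - epsT L k) ^ n * (phase L k (r + -ex L)).re
            + (4 - epsT L k) ^ n * (phase L k (r + ey L)).re
            + (4 - epsT L k) ^ n * (phase L k (r + -ey L)).re) := by
    intro k
    rw [pow_succ, mul_assoc, b_mul_phase_re]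
    ring
  rw [Finset.sum_congr rfl fun k _ => hpt k, Finset.sum_add_distrib, ← Finset.mul_sum, ← Finset.mul_sum,
    Finset.sum_add_distrib, Finset.sum_add_distrib, Finset.sum_add_distrib]

/-- **`S_n(r) ≥ 0`** (entrywise non-negativity of `Bⁿ`). [folklore] -/
theorem S_nonneg (n : ℕ) : ∀ r : Tor L, 0 ≤ ∑ k : Tor L, (4 - epsT L k) ^ n * (phase L k r).re := by
  induction n with
  | zero =>
    intro r
    simp only [pow_zero, one_mul]
    rw [← Complex.re_sum, sum_phase_left]
    split_ifs
    · rw [show ((L : ℂ) ^ 2) = (((L : ℝ) ^ 2 : ℝ) : ℂ) by push_cast; ring, Complex.ofReal_re]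
      positivity
    · simp
  | succ n ih =>
    intro r
    rw [S_succ]
    have h0 := ih r
    have h1 := ih (r + ex L)
    have h2 := ih (r + -ex L)
    have h3 := ih (r + ey L)
    have h4 := ih (r + -ey L)
    positivity

/-- `Σ_{k ≠ 0} b(k)ⁿ Re φ_k(r) = S_n(r) − 4ⁿ ≥ −4ⁿ`. [folklore] -/
theorem sum_erase_b_pow_ge (n : ℕ) (r : Tor L) :
    -(4 : ℝ) ^ n ≤ ∑ k ∈ (Finset.univ : Finset (Tor L)).erase 0, (4 - epsT L k) ^ n * (phase L k r).re := by
  classical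
  have h := S_nonneg L n r
  rw [← Finset.add_sum_erase _ _ (Finset.mem_univ (0 : Tor L)), epsT_zero, phase_zero_left, Complex.one_re,
    sub_zero, mul_one] at h
  linarith

/-! ## Elementary facts -/

/-- the finite geometric identity `1/(c − b) = Σ_{n<N} bⁿ/c^{n+1} + (bᴺ/cᴺ)·(1/(c − b))`. [folklore] -/
theorem geom_identity (c b : ℝ) (hc : c ≠ 0) (hcb : c - b ≠ 0) (N : ℕ) :
    1 / (c - b) = ∑ n ∈ Finset.range N, b ^ n / c ^ (n + 1) + b ^ N / c ^ N * (1 / (c - b)) := by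
  induction N with
  | zero => simp
  | succ N ih =>
    rw [Finset.sum_range_succ]
    have step : b ^ N / c ^ N * (1 / (c - b)) = b ^ N / c ^ (N + 1) + b ^ (N + 1) / c ^ (N + 1) * (1 / (c - b)) := by
      have hcN : c ^ N ≠ 0 := pow_ne_zero _ hc
      have hcN1 : c ^ (N + 1) ≠ 0 := pow_ne_zero _ hc
      field_simp
      ring
    conv_lhs => rw [ih]
    rw [step]
    ring

omit [NeZero L] in
/-- `ε(k) ≤ 4`. [folklore] -/
theorem epsT_le_four (k : Tor L) : epsT L k ≤ 4 := by
  unfold epsT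
  have h1 := Real.neg_one_le_cos (2 * Real.pi * k.1.val / L)
  have h2 := Real.neg_one_le_cos (2 * Real.pi * k.2.val / L)
  linarith

/-- `−1 ≤ Re φ_k(r)`. [folklore] -/
theorem neg_one_le_phase_re (k r : Tor L) : -1 ≤ (phase L k r).re := by
  have h := Complex.abs_re_le_norm (phase L k r)
  rw [norm_phase] at h
  exact (abs_le.mp h).1

/-! ## `GeomGMin` -/

/-- ★ **`GeomGMin L` holds.** [folklore] -/
theorem geomGMin_holds : GeomGMin L := by
  classical
  intro lam2 hl0 hl2 n0 r
  -- `L ≥ 2` (for `L = 1`, `ε₁ = 0` contradicts `0 < λ < 2ε₁`)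
  have hL2 : 2 ≤ L := by
    by_contra h
    have hL1 : (L : ℝ) = 1 := by have := NeZero.ne L; exact_mod_cast (show L = 1 by omega)
    have : eps1 L = 0 := by unfold eps1; rw [hL1, div_one, Real.cos_two_pi]; ring
    linarith
  have heps2 : eps1 L ≤ 2 := by
    unfold eps1; have := Real.neg_one_le_cos (2 * Real.pi / L); linarith
  have hVpos : (0 : ℝ) < (L : ℝ) ^ 2 := by
    have : (0 : ℝ) < L := by exact_mod_cast (show 0 < L by omega)
    positivity
  set c0 : ℝ := 4 - lam2 / 2 with hc0
  have hc0pos : 0 < c0 := by rw [hc0]; linarith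
  -- off the origin: `g(k) = 1/(2(c₀ − b(k))) > 0`, `b(k) ≥ 0`
  have hgap : ∀ k : Tor L, k ≠ 0 → 0 < c0 - (4 - epsT L k) := by
    intro k hk; have := eps1_le_epsT L hL2 hk; rw [hc0]; linarith
  have hgres : ∀ k : Tor L, k ≠ 0 → gres L lam2 k = 1 / (2 * (c0 - (4 - epsT L k))) := by
    intro k hk
    unfold gres
    rw [if_neg hk, hc0]
    congr 1; ring
  have hgres_pos : ∀ k : Tor L, k ≠ 0 → 0 < gres L lam2 k := by
    intro k hk; rw [hgres k hk]; have := hgap k hk; positivity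
  -- the main inequality before dividing by `V`
  have key : -(∑ k : Tor L, gres L lam2 k * (phase L k r).re)
      ≤ (1 / 2 : ℝ) * (∑ n ∈ Finset.range n0, (4 : ℝ) ^ n / c0 ^ (n + 1))
        + ∑ k ∈ (Finset.univ : Finset (Tor L)).erase 0, ((4 - epsT L k) / c0) ^ n0 * gres L lam2 k := by
    -- drop the `k = 0` term
    rw [← Finset.add_sum_erase _ _ (Finset.mem_univ (0 : Tor L))]
    have hg0 : gres L lam2 0 = 0 := by unfold gres; rw [if_pos rfl]
    rw [hg0, zero_mul, zero_add]
    -- expand `g(k)` by the geometric identity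
    have hexp : ∀ k ∈ (Finset.univ : Finset (Tor L)).erase 0,
        gres L lam2 k * (phase L k r).re
          = (1 / 2 : ℝ) * ∑ n ∈ Finset.range n0, ((4 - epsT L k) ^ n * (phase L k r).re) / c0 ^ (n + 1)
            + ((4 - epsT L k) / c0) ^ n0 * gres L lam2 k * (phase L k r).re := by
      intro k hk
      have hk0 : k ≠ 0 := Finset.ne_of_mem_erase hk
      set b : ℝ := 4 - epsT L k with hb
      have hid := geom_identity c0 b hc0pos.ne' (hgap k hk0).ne' n0
      have hg : gres L lam2 k = (1 / 2 : ℝ) * (1 / (c0 - b)) := by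
        rw [hgres k hk0, ← hb]; field_simp
      have e1 : gres L lam2 k
          = (1 / 2 : ℝ) * ∑ n ∈ Finset.range n0, b ^ n / c0 ^ (n + 1) + (b / c0) ^ n0 * gres L lam2 k := by
        rw [hg, div_pow]
        conv_lhs => rw [hid]
        ring
      have hS : (∑ n ∈ Finset.range n0, b ^ n / c0 ^ (n + 1)) * (phase L k r).re
          = ∑ n ∈ Finset.range n0, (b ^ n * (phase L k r).re) / c0 ^ (n + 1) := by
        rw [Finset.sum_mul]
        refine Finset.sum_congr rfl fun n _ => ?_
        ring
      calc gres L lam2 k * (phase L k r).re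
          = ((1 / 2 : ℝ) * ∑ n ∈ Finset.range n0, b ^ n / c0 ^ (n + 1) + (b / c0) ^ n0 * gres L lam2 k)
              * (phase L k r).re := by rw [← e1]
        _ = _ := by rw [add_mul, mul_assoc, hS]
    rw [Finset.sum_congr rfl hexp, Finset.sum_add_distrib, ← Finset.mul_sum, Finset.sum_comm]
    -- first block: `−½ Σ_n (1/c₀^{n+1}) Σ_{k≠0} bⁿ Re φ ≤ ½ Σ_n 4ⁿ/c₀^{n+1}`
    have hA : ∀ n ∈ Finset.range n0,
        -((4 : ℝ) ^ n / c0 ^ (n + 1))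
          ≤ ∑ k ∈ (Finset.univ : Finset (Tor L)).erase 0, ((4 - epsT L k) ^ n * (phase L k r).re) / c0 ^ (n + 1) := by
      intro n _
      rw [← Finset.sum_div, ← neg_div]
      exact div_le_div_of_nonneg_right (sum_erase_b_pow_ge L n r) (pow_pos hc0pos _).le
    have hAsum := Finset.sum_le_sum hA
    rw [Finset.sum_neg_distrib] at hAsum
    -- second block: `−Σ_{k≠0} w_k Re φ ≤ Σ_{k≠0} w_k`, `w_k = (b/c₀)^{n₀} g(k) ≥ 0`
    have hB : ∀ k ∈ (Finset.univ : Finset (Tor L)).erase 0,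
        -(((4 - epsT L k) / c0) ^ n0 * gres L lam2 k)
          ≤ ((4 - epsT L k) / c0) ^ n0 * gres L lam2 k * (phase L k r).re := by
      intro k hk
      have hk0 : k ≠ 0 := Finset.ne_of_mem_erase hk
      have hw : 0 ≤ ((4 - epsT L k) / c0) ^ n0 * gres L lam2 k := by
        have hb : 0 ≤ 4 - epsT L k := by have := epsT_le_four L k; linarith
        have := hgres_pos k hk0
        positivity
      have hre := neg_one_le_phase_re L k r
      nlinarith
    have hBsum := Finset.sum_le_sum hB
    rw [Finset.sum_neg_distrib] at hBsum
    linarith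
  -- divide by `V`
  have hlhs : -Gres L lam2 r = -(∑ k : Tor L, gres L lam2 k * (phase L k r).re) / (L : ℝ) ^ 2 := by
    unfold Gres; rw [neg_div]
  have hrhs : (1 / 2 : ℝ) * (∑ n ∈ Finset.range n0, (4 : ℝ) ^ n / (c0 ^ (n + 1) * (L : ℝ) ^ 2))
      + (∑ k ∈ (Finset.univ : Finset (Tor L)).erase 0, ((4 - epsT L k) / c0) ^ n0 * gres L lam2 k)
          / (L : ℝ) ^ 2
      = ((1 / 2 : ℝ) * (∑ n ∈ Finset.range n0, (4 : ℝ) ^ n / c0 ^ (n + 1))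
          + ∑ k ∈ (Finset.univ : Finset (Tor L)).erase 0, ((4 - epsT L k) / c0) ^ n0 * gres L lam2 k)
        / (L : ℝ) ^ 2 := by
    rw [add_div]
    congr 1
    rw [Finset.mul_sum, Finset.mul_sum, Finset.sum_div]
    refine Finset.sum_congr rfl fun n _ => ?_
    have hcn : c0 ^ (n + 1) ≠ 0 := pow_ne_zero _ hc0pos.ne'
    field_simp
  rw [hlhs, hrhs]
  exact div_le_div_of_nonneg_right key hVpos.le

end Summit.HubbardSuperconductivity.HubbardSuperconductivity.Theorems.AnisotropyChord.Transfer.Fibre3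

end
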